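import Literature.MathematicalPhysics.QuantumLattice.TorusBandClosedShells
import Literature.MathematicalPhysics.QuantumLattice.FreeFermionSectorGroundStates
import Summits.HubbardSuperconductivity.HubbardSuperconductivity.Theorems.BalabanIRBirEveryGroundStateStubLiebAnchor
import HarnessLib

/-!
# Route `JosephsonMirror` — crux `JmCusp` (stmt-HubbardSuperconductivity-2228):
# clause (ii) of the bet FAILS for free layers at every doping

The `U = 0` calibration of the eventual-simplicity clause (ii) of `Theses.JosephsonMirror.JmCusp`
("for all large even `L` the ground state of `hubbardTorus 2 L 1 U` in `(N_L, S^z = 0)`,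
`N_L = 2⌊(1-δ)L²/2⌋`, is unique up to scalars"), the twin of the route's landed `U = 0` calibration of
clause (i) (`JmFreeLayersNoCusp`, stmt-2232):

* `exists_even_ge_two_groundStates_free` — for EVERY `δ ∈ (0, 1)` and every `L₀` there is an even
  `L ≥ L₀` at which the free floor of `(N_L, S^z = 0)` is degenerate: two paired Fermi seas
  `Π_{k∈F} b†_k |0⟩`, `Π_{k∈F'} b†_k |0⟩` over different Fermi sets are ground states and are not
  proportional.  Mechanism: the shell number `n_L = ⌊(1-δ)L²/2⌋` is `≢ 1 (mod 4)` for some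
  `L ∈ {2m, 4m, 6m, 8m}` (`exists_even_ge_floor_mod_four_ne_one`), whereas every CLOSED shell of the
  even torus strictly below the van Hove level holds `≡ 1 (mod 4)` momenta (`torusLevelCount_mod_four`)
  and the closed shells at or above it hold more than `L²/2 > n_L` (`sq_lt_two_mul_card_filter_torusBand_le_zero`);
  so the shell of `n_L` is open, and an open free shell has a degenerate floor
  (`exists_two_groundStates_free_of_openShell`).
* `not_eventualSimplicity_free` — hence clause (ii) with `U := 0` is false for every `δ ∈ (0, 1)`;
  `jmCusp_clauseII_fails_at_zero_coupling` — in particular on the bet's doping window `(0, 1/2)`.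
* `eventualSimplicity_attractive` / `jmCusp_clauseII_holds_at_attractive_coupling` — on the other
  side of the free point clause (ii) HOLDS for every `U < 0`, every `δ ≥ 0` and every `L ≥ 1`: Lieb's
  Theorem 1 on the connected torus (`finrank_szSector_groundEigenspace_eq_one`,
  `fermionTorusGraph_connected`, landed for route `BalabanIR`).  Net calibration of (ii) along the
  coupling axis at fixed doping: TRUE for `U < 0`, FALSE at `U = 0`, OPEN for `U > 0`.

Reading for the crux: (ii) is non-perturbative at every `(U, δ)` — no argument of the form "the free
floor is simple and a small interaction cannot close the gap" runs along all large even `L`; a proof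
of (ii) at a point `(U, δ)` must show that the interaction splits the open-shell multiplets for all but
finitely many even `L` (c.f. the `L = 4` exact diagonalisation `Cruxes/JmCusp/Numerics-ed44-L4.md`:
simple at `δ = 3/8` (closed shell `n = 5`), degenerate at `δ = 1/4` (open shell `n = 6`)).

Sources: J. Bardeen, L. N. Cooper, J. R. Schrieffer, Phys. Rev. 108 (1957) 1175 §II; E. H. Lieb,
PRL 62 (1989) 1201; D. J. Scalapino, Phys. Rep. 250 (1995) 329 §2.  Folklore finite-dimensional
statements; no definitions, no named facts.
-/

-- the mandated namespace `Summit.<Summit>.<Problem>.Theorems` repeats `HubbardSuperconductivity`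
-- (single-problem summit, D-0017), which the `dupNamespace` linter flags on every declaration
set_option linter.dupNamespace false

noncomputable section

namespace Summit.HubbardSuperconductivity.HubbardSuperconductivity.Theorems.JosephsonMirror

open Matrix Finset Literature.MathematicalPhysics.QuantumLattice Literature.Probability.LatticeModels

/-! ### Floors of `y, 4y, 9y, 16y` modulo `4` -/

/-- **One of `⌊y⌋, ⌊4y⌋, ⌊9y⌋, ⌊16y⌋` is `≢ 1 (mod 4)`** (`y ≥ 0`). If `⌊y⌋ ≡ ⌊4y⌋ ≡ ⌊16y⌋ ≡ 1` then
`⌊16y⌋ ≡ 21 (mod 64)`, which pins `⌊9y⌋` to `{36c + 11, 36c + 12}`, neither `≡ 1`. [folklore] -/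
theorem exists_sq_floor_mod_four_ne_one {y : ℝ} (hy : 0 ≤ y) :
    ¬ (⌊y⌋₊ % 4 = 1 ∧ ⌊4 * y⌋₊ % 4 = 1 ∧ ⌊9 * y⌋₊ % 4 = 1 ∧ ⌊16 * y⌋₊ % 4 = 1) := by
  rintro ⟨h1, h4, h9, h16⟩
  set a := ⌊y⌋₊ with ha
  set b := ⌊4 * y⌋₊ with hb
  set c := ⌊9 * y⌋₊ with hc
  set d := ⌊16 * y⌋₊ with hd
  have ha1 : (a : ℝ) ≤ y := Nat.floor_le hy
  have ha2 : y < a + 1 := Nat.lt_floor_add_one y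
  have hb1 : (b : ℝ) ≤ 4 * y := Nat.floor_le (by positivity)
  have hb2 : 4 * y < b + 1 := Nat.lt_floor_add_one _
  have hc1 : (c : ℝ) ≤ 9 * y := Nat.floor_le (by positivity)
  have hc2 : 9 * y < c + 1 := Nat.lt_floor_add_one _
  have hd1 : (d : ℝ) ≤ 16 * y := Nat.floor_le (by positivity)
  have hd2 : 16 * y < d + 1 := Nat.lt_floor_add_one _
  -- integer consequences
  have i1 : 4 * a ≤ b := by
    have : (4 * a : ℝ) < b + 1 := by linarith
    have : 4 * a < b + 1 := by exact_mod_cast this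
    omega
  have i2 : b ≤ 4 * a + 3 := by
    have : (b : ℝ) < 4 * a + 4 := by linarith
    have : b < 4 * a + 4 := by exact_mod_cast this
    omega
  have i3 : 4 * b ≤ d := by
    have : (4 * b : ℝ) < d + 1 := by linarith
    have : 4 * b < d + 1 := by exact_mod_cast this
    omega
  have i4 : d ≤ 4 * b + 3 := by
    have : (d : ℝ) < 4 * b + 4 := by linarith
    have : d < 4 * b + 4 := by exact_mod_cast this
    omega
  have i5 : 9 * d < 16 * c + 16 := by
    have : (9 * d : ℝ) < 16 * c + 16 := by linarith
    exact_mod_cast this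
  have i6 : 16 * c < 9 * d + 9 := by
    have : (16 * c : ℝ) < 9 * d + 9 := by linarith
    exact_mod_cast this
  omega

/-- **At every doping the free shell number leaves the residue `1 (mod 4)` infinitely often**: for
`0 ≤ x` (`x = 1 - δ`) and every `L₀` there is an even `L ≥ max L₀ 4` with `⌊x L²/2⌋ ≢ 1 (mod 4)`
(take `L ∈ {2m, 4m, 6m, 8m}`, `m = max L₀ 2`: `x L²/2 = r² · 2xm²`). [folklore] -/
theorem exists_even_ge_floor_mod_four_ne_one {x : ℝ} (hx : 0 ≤ x) (L₀ : ℕ) :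
    ∃ L : ℕ, Even L ∧ L₀ ≤ L ∧ 4 ≤ L ∧ ⌊x * (L : ℝ) ^ 2 / 2⌋₊ % 4 ≠ 1 := by
  set m : ℕ := max L₀ 2 with hm
  have hm2 : 2 ≤ m := le_max_right _ _
  have hmL : L₀ ≤ m := le_max_left _ _
  set y : ℝ := 2 * x * (m : ℝ) ^ 2 with hy
  have hy0 : 0 ≤ y := by positivity
  have key : ∀ r : ℕ, ⌊x * ((2 * r * m : ℕ) : ℝ) ^ 2 / 2⌋₊ = ⌊((r : ℝ)) ^ 2 * y⌋₊ := fun r => by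
    congr 1
    push_cast
    rw [hy]
    ring
  have h := exists_sq_floor_mod_four_ne_one hy0
  by_cases h1 : ⌊y⌋₊ % 4 = 1
  · by_cases h4 : ⌊4 * y⌋₊ % 4 = 1
    · by_cases h9 : ⌊9 * y⌋₊ % 4 = 1
      · have h16 : ⌊16 * y⌋₊ % 4 ≠ 1 := fun h16 => h ⟨h1, h4, h9, h16⟩
        refine ⟨2 * 4 * m, ⟨4 * m, by ring⟩, by omega, by omega, ?_⟩
        rw [key 4]; norm_num; exact h16
      · refine ⟨2 * 3 * m, ⟨3 * m, by ring⟩, by omega, by omega, ?_⟩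
        rw [key 3]; norm_num; exact h9
    · refine ⟨2 * 2 * m, ⟨2 * m, by ring⟩, by omega, by omega, ?_⟩
      rw [key 2]; norm_num; exact h4
  · refine ⟨2 * 1 * m, ⟨1 * m, by ring⟩, by omega, by omega, ?_⟩
    rw [key 1]; norm_num; exact h1

/-! ### The free shell of `n_L` electrons per spin is open infinitely often -/

/-- **The free shell of `n` electrons per spin is open unless `n ≡ 1 (mod 4)`** (even `L`,
`1 ≤ n`, `2n < L²`): with `μ = torusFermiLevel L (2n)`, `#{ε_L < μ} < n < #{ε_L ≤ μ}`. [folklore] -/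
theorem openShell_of_mod_four_ne_one {L : ℕ} [NeZero L] (hL : Even L) {n : ℕ} (hn : 1 ≤ n)
    (hnL : 2 * n < L ^ 2) (hmod : n % 4 ≠ 1) :
    (univ.filter fun k : TorusSite 2 L => torusBand L k < torusFermiLevel L (2 * n)).card < n ∧
      n < (univ.filter fun k : TorusSite 2 L => torusBand L k ≤ torusFermiLevel L (2 * n)).card := by
  classical
  have hN : 0 < 2 * n := by omega
  have hNL : 2 * n ≤ 2 * L ^ 2 := by omega
  set μ := torusFermiLevel L (2 * n) with hμ
  -- below the Fermi level fewer than `n` levels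
  have hlt : (univ.filter fun k : TorusSite 2 L => torusBand L k < μ).card < n := by
    set B := univ.filter fun k : TorusSite 2 L => torusBand L k < μ with hB
    rcases B.eq_empty_or_nonempty with hB0 | hBne
    · rw [hB0, card_empty]; omega
    · set E := B.sup' hBne (torusBand L) with hE
      have hEμ : E < μ := by
        obtain ⟨k, hk, hkE⟩ := exists_mem_eq_sup' hBne (torusBand L)
        rw [hE, hkE]
        exact (mem_filter.1 hk).2
      have hsub : B ⊆ univ.filter fun k : TorusSite 2 L => torusBand L k ≤ E := fun k hk =>
        mem_filter.2 ⟨mem_univ _, le_sup' (torusBand L) hk⟩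
      have h1 : B.card ≤ torusLevelCount L E := by
        rw [torusLevelCount_def]; exact card_le_card hsub
      have h2 := two_mul_torusLevelCount_lt hN hNL hEμ
      omega
  refine ⟨hlt, ?_⟩
  -- the shell of `n` is not closed
  have hle : n ≤ (univ.filter fun k : TorusSite 2 L => torusBand L k ≤ μ).card := by
    have h := le_two_mul_torusLevelCount_torusFermiLevel (L := L) hN hNL
    rw [torusLevelCount_def, ← hμ] at h
    omega
  refine lt_of_le_of_ne hle fun heq => ?_
  rcases lt_or_ge μ 0 with hμ0 | hμ0
  · -- closed shell strictly below the van Hove level: `≡ 1 (mod 4)`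
    have hμ4 : -4 ≤ μ := by
      obtain ⟨k, hk⟩ := exists_torusBand_eq_torusFermiLevel (L := L) hN hNL
      rw [hμ, ← hk]
      exact neg_four_le_torusBand L k
    have hm := torusLevelCount_mod_four hL hμ4 hμ0
    rw [torusLevelCount_def, ← heq] at hm
    exact hmod hm
  · -- closed shell at or above the van Hove level: more than `L²/2` levels
    have hbig := sq_lt_two_mul_card_filter_torusBand_le_zero (L := L) hL
    have hmono : (univ.filter fun k : TorusSite 2 L => torusBand L k ≤ 0).card ≤
        (univ.filter fun k : TorusSite 2 L => torusBand L k ≤ μ).card :=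
      card_le_card (monotone_filter_right _ fun k _ (hk : torusBand L k ≤ 0) => hk.trans hμ0)
    omega

/-- **At every doping the free `(N_L, S^z = 0)` floor is degenerate for infinitely many even `L`.**
For `0 < δ < 1` and every `L₀` there is an even `L ≥ L₀` and two ground states `φ, φ'` of
`hubbardTorus 2 L 1 0` in the sector `(2⌊(1-δ)L²/2⌋, S^z = 0)` with `φ' ≠ c • φ` for every scalar
`c`. Bardeen–Cooper–Schrieffer (1957) §II (open-shell Fermi seas). [folklore] -/
theorem exists_even_ge_two_groundStates_free {δ : ℝ} (hδ0 : 0 < δ) (hδ1 : δ < 1) (L₀ : ℕ) :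
    ∃ L : ℕ, Even L ∧ L₀ ≤ L ∧
      ∃ φ φ' : Fock (Orb (FermionTorus 2 L)),
        IsGroundStateInSector (hubbardTorus 2 L 1 0) (2 * ⌊(1 - δ) * (L : ℝ) ^ 2 / 2⌋₊) 0 φ ∧
          IsGroundStateInSector (hubbardTorus 2 L 1 0) (2 * ⌊(1 - δ) * (L : ℝ) ^ 2 / 2⌋₊) 0 φ' ∧
            ∀ c : ℂ, φ' ≠ c • φ := by
  have hx : 0 < 1 - δ := by linarith
  -- `L` large enough for `n_L ≥ 1`, even, with `n_L ≢ 1 (mod 4)`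
  obtain ⟨L, hLe, hLge, hL4, hmod⟩ :=
    exists_even_ge_floor_mod_four_ne_one hx.le (max L₀ (⌈2 / (1 - δ)⌉₊))
  haveI : NeZero L := ⟨by omega⟩
  have hL0 : L₀ ≤ L := le_trans (le_max_left _ _) hLge
  have hLc : ⌈2 / (1 - δ)⌉₊ ≤ L := le_trans (le_max_right _ _) hLge
  set n : ℕ := ⌊(1 - δ) * (L : ℝ) ^ 2 / 2⌋₊ with hn
  have hLr : (2 / (1 - δ) : ℝ) ≤ L := le_trans (Nat.le_ceil _) (by exact_mod_cast hLc)
  have hL1 : (1 : ℝ) ≤ L := by exact_mod_cast (show 1 ≤ L by omega)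
  have hn1 : 1 ≤ n := by
    refine Nat.le_floor ?_
    rw [Nat.cast_one]
    have h2 : 2 ≤ (1 - δ) * L := by
      rw [div_le_iff₀ hx] at hLr; linarith
    have : (1 - δ) * L ≤ (1 - δ) * (L : ℝ) ^ 2 := by
      rw [sq]; exact mul_le_mul_of_nonneg_left (le_mul_of_one_le_left (by positivity) hL1) hx.le
    linarith
  have hnL : 2 * n < L ^ 2 := by
    have h1 : (n : ℝ) ≤ (1 - δ) * (L : ℝ) ^ 2 / 2 := Nat.floor_le (by positivity)
    have h2 : (1 - δ) * (L : ℝ) ^ 2 / 2 < (L : ℝ) ^ 2 / 2 := by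
      rw [div_lt_div_iff_of_pos_right two_pos]
      have hL2 : (0 : ℝ) < (L : ℝ) ^ 2 := by positivity
      nlinarith
    have h3 : (2 * n : ℝ) < (L : ℝ) ^ 2 := by linarith
    exact_mod_cast h3
  obtain ⟨hlt, hgt⟩ := openShell_of_mod_four_ne_one hLe hn1 hnL hmod
  obtain ⟨φ, φ', hφ, hφ', hne⟩ :=
    exists_two_groundStates_free_of_openShell (by omega) (torusFermiLevel L (2 * n)) n hlt hgt
  exact ⟨L, hLe, hL0, φ, φ', hφ, hφ', hne⟩

/-- **Clause (ii) of `JmCusp` fails for free layers at every doping.** For `0 < δ < 1` it is NOT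
the case that for all large even `L` the ground state of the free torus `hubbardTorus 2 L 1 0` in the
sector `(2⌊(1-δ)L²/2⌋, S^z = 0)` is unique up to scalars (clause (ii) of
`Theses.JosephsonMirror.JmCusp` with `U := 0`, verbatim). [folklore] -/
theorem not_eventualSimplicity_free {δ : ℝ} (hδ0 : 0 < δ) (hδ1 : δ < 1) :
    ¬ ∃ L₀ : ℕ, ∀ (L : ℕ), Even L → L₀ ≤ L →
      ∀ φ φ' : Literature.MathematicalPhysics.QuantumLattice.Fock (Literature.MathematicalPhysics.QuantumLattice.Orb (Literature.MathematicalPhysics.QuantumLattice.FermionTorus 2 L)), Literature.MathematicalPhysics.QuantumLattice.IsGroundStateInSector (Literature.MathematicalPhysics.QuantumLattice.hubbardTorus 2 L 1 0) (2 * ⌊(1 - δ) * (L : ℝ) ^ 2 / 2⌋₊) 0 φ → Literature.MathematicalPhysics.QuantumLattice.IsGroundStateInSector (Literature.MathematicalPhysics.QuantumLattice.hubbardTorus 2 L 1 0) (2 * ⌊(1 - δ) * (L : ℝ) ^ 2 / 2⌋₊) 0 φ' → ∃ c : ℂ, φ' = c • φ := by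
  rintro ⟨L₀, h⟩
  obtain ⟨L, hLe, hL0, φ, φ', hφ, hφ', hne⟩ := exists_even_ge_two_groundStates_free hδ0 hδ1 L₀
  obtain ⟨c, hc⟩ := h L hLe hL0 φ φ' hφ hφ'
  exact hne c hc

/-- **The `U = 0` calibration of clause (ii) of the bet** (route `JosephsonMirror`, crux
stmt-HubbardSuperconductivity-2228): on the whole doping window `δ ∈ (0, 1/2)` of `JmCusp`, the
eventual-simplicity clause (ii) is FALSE for free layers — the twin of `JmFreeLayersNoCusp` (the probe
of clause (i) does not fire on free layers).  So both clauses of the bet are genuinely interacting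
statements at every doping. [folklore] -/
theorem jmCusp_clauseII_fails_at_zero_coupling :
    ∀ δ ∈ Set.Ioo (0:ℝ) (1 / 2), ¬ ∃ L₀ : ℕ, ∀ (L : ℕ), Even L → L₀ ≤ L →
      ∀ φ φ' : Literature.MathematicalPhysics.QuantumLattice.Fock (Literature.MathematicalPhysics.QuantumLattice.Orb (Literature.MathematicalPhysics.QuantumLattice.FermionTorus 2 L)), Literature.MathematicalPhysics.QuantumLattice.IsGroundStateInSector (Literature.MathematicalPhysics.QuantumLattice.hubbardTorus 2 L 1 0) (2 * ⌊(1 - δ) * (L : ℝ) ^ 2 / 2⌋₊) 0 φ → Literature.MathematicalPhysics.QuantumLattice.IsGroundStateInSector (Literature.MathematicalPhysics.QuantumLattice.hubbardTorus 2 L 1 0) (2 * ⌊(1 - δ) * (L : ℝ) ^ 2 / 2⌋₊) 0 φ' → ∃ c : ℂ, φ' = c • φ :=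
  fun _ hδ => not_eventualSimplicity_free hδ.1 (by linarith [hδ.2])


/-! ### The attractive side: clause (ii) HOLDS for every `U < 0` (Lieb's Theorem 1) -/

/-- **Clause (ii) holds at every attractive coupling and every doping.** For `U < 0` and `0 ≤ δ`,
for EVERY `L ≥ 1` (no largeness needed) any two ground states of `hubbardTorus 2 L 1 U` in the joint
sector `(2⌊(1-δ)L²/2⌋, S^z = 0)` are proportional: the sector ground eigenspace is one-dimensional
by Lieb's Theorem 1 on the connected torus graph (`finrank_szSector_groundEigenspace_eq_one`,
`fermionTorusGraph_connected`, both landed for route `BalabanIR`). Lieb, PRL 62 (1989) 1201,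
Theorem 1. [cite: LiebPRL1989, Theorem 1] -/
theorem eventualSimplicity_attractive {U : ℝ} (hU : U < 0) {δ : ℝ} (hδ : 0 ≤ δ) :
    ∃ L₀ : ℕ, ∀ (L : ℕ), Even L → L₀ ≤ L →
      ∀ φ φ' : Fock (Orb (FermionTorus 2 L)),
        IsGroundStateInSector (hubbardTorus 2 L 1 U) (2 * ⌊(1 - δ) * (L : ℝ) ^ 2 / 2⌋₊) 0 φ →
          IsGroundStateInSector (hubbardTorus 2 L 1 U) (2 * ⌊(1 - δ) * (L : ℝ) ^ 2 / 2⌋₊) 0 φ' →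
            ∃ c : ℂ, φ' = c • φ := by
  refine ⟨1, fun L _ hL φ φ' hφ hφ' => ?_⟩
  haveI : NeZero L := ⟨by omega⟩
  set n : ℕ := ⌊(1 - δ) * (L : ℝ) ^ 2 / 2⌋₊ with hn
  have hcard : Fintype.card (FermionTorus 2 L) = L ^ 2 := by
    simp [FermionTorus, Fintype.card_fin]
  have hnL : n ≤ Fintype.card (FermionTorus 2 L) := by
    rw [hcard]
    have h1 : (1 - δ) * (L : ℝ) ^ 2 / 2 ≤ ((L ^ 2 : ℕ) : ℝ) := by
      push_cast
      have hL2 : (0 : ℝ) ≤ (L : ℝ) ^ 2 := by positivity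
      nlinarith
    calc n ≤ ⌊((L ^ 2 : ℕ) : ℝ)⌋₊ := Nat.floor_mono h1
      _ = L ^ 2 := Nat.floor_natCast _
  have hfin := finrank_szSector_groundEigenspace_eq_one (fermionTorusGraph 2 L)
    (fermionTorusGraph_connected 2 L) one_ne_zero hU hnL
  set H := hubbardTorus 2 L 1 U with hH
  set W : Submodule ℂ (Fock (Orb (FermionTorus 2 L))) := szSector (Λ := FermionTorus 2 L) (2 * n) 0 ⊓
      Module.End.eigenspace (Matrix.toLin' H) (((H.minEnergyOn (szSector (2 * n) 0) : ℝ) : ℂ)) with hW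
  have hmem : ∀ ψ : Fock (Orb (FermionTorus 2 L)), IsGroundStateInSector H (2 * n) 0 ψ → ψ ∈ W :=
    fun ψ hψ => Submodule.mem_inf.2
      ⟨hψ.1, Module.End.mem_eigenspace_iff.2 (by rw [Matrix.toLin'_apply]; exact hψ.2.2)⟩
  have hφ0 : (⟨φ, hmem φ hφ⟩ : W) ≠ 0 := fun h => hφ.2.1 (congrArg Subtype.val h)
  obtain ⟨c, hc⟩ := (finrank_eq_one_iff_of_nonzero' (⟨φ, hmem φ hφ⟩ : W) hφ0).1 hfin ⟨φ', hmem φ' hφ'⟩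
  exact ⟨c, (congrArg Subtype.val hc).symm⟩

/-- **The attractive calibration of clause (ii) of the bet** (route `JosephsonMirror`, crux
stmt-HubbardSuperconductivity-2228): for every `U < 0` and every `δ` in the bet's window `(0, 1/2)`
the eventual-simplicity clause (ii) of `JmCusp` (with `U` in place of the bet's positive coupling)
HOLDS.  Together with `jmCusp_clauseII_fails_at_zero_coupling`: along the coupling axis at fixed
doping, clause (ii) is TRUE for all `U < 0`, FALSE at `U = 0`, and open for `U > 0` (where the bet
places it). Lieb, PRL 62 (1989) 1201, Theorem 1. [cite: LiebPRL1989, Theorem 1] -/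
theorem jmCusp_clauseII_holds_at_attractive_coupling :
    ∀ U : ℝ, U < 0 → ∀ δ ∈ Set.Ioo (0:ℝ) (1 / 2), ∃ L₀ : ℕ, ∀ (L : ℕ), Even L → L₀ ≤ L →
      ∀ φ φ' : Literature.MathematicalPhysics.QuantumLattice.Fock (Literature.MathematicalPhysics.QuantumLattice.Orb (Literature.MathematicalPhysics.QuantumLattice.FermionTorus 2 L)), Literature.MathematicalPhysics.QuantumLattice.IsGroundStateInSector (Literature.MathematicalPhysics.QuantumLattice.hubbardTorus 2 L 1 U) (2 * ⌊(1 - δ) * (L : ℝ) ^ 2 / 2⌋₊) 0 φ → Literature.MathematicalPhysics.QuantumLattice.IsGroundStateInSector (Literature.MathematicalPhysics.QuantumLattice.hubbardTorus 2 L 1 U) (2 * ⌊(1 - δ) * (L : ℝ) ^ 2 / 2⌋₊) 0 φ' → ∃ c : ℂ, φ' = c • φ :=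
  fun _ hU _ hδ => eventualSimplicity_attractive hU hδ.1.le

end Summit.HubbardSuperconductivity.HubbardSuperconductivity.Theorems.JosephsonMirror

end
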